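import Summits.BirchSwinnertonDyer.BirchSwinnertonDyer.Theorems.BiquadraticEisensteinDescentHeegnerTwistCouplingInSupplySymbolicMonskyTwoPrimeRows
import Summits.BirchSwinnertonDyer.BirchSwinnertonDyer.Theorems.BiquadraticEisensteinDescentHeegnerTwistCouplingInSupplySymbolicMonskyLeftKernel
import Mathlib.Tactic.ReduceModChar
import HarnessLib

set_option linter.dupNamespace false -- `Summit.BirchSwinnertonDyer.BirchSwinnertonDyer.Theorems.…` (summit = sub)
set_option autoImplicit false

/-!
# Crux `HeegnerTwistCouplingInSupply` (stmt-BirchSwinnertonDyer-21381) — the TWO-PRIME RECIPE, part 2: the core identities and injectivity on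
# `Q`-constant vectors

Route `BiquadraticEisensteinDescent` (cell `pub/bsd-wall`, width seat `bsd-wall-cm-bed-w3` g21; `--supports` 21381, helper). File (2/3) of the
existence theorem «`s* = 2` ⇒ a pattern-free Heegner recipe with two auxiliary primes» (memo PATTERN-FREE-STRUCTURE-w3g21 §5b).

Setting: base datum `base`, two auxiliary cells `c₁ ≡ 3 (4)`, `c₂ ≡ 1 (4)` with the same `(2/·)`-class `ε̂`, `c₁`'s symbol bits `= m + σ` where
`σ` = `c₂`'s bits has ODD weight; a virtual kernel pair `(u¹, w¹)` of the base (`(L+D_m)u¹ + D_d w¹ = 0`, `D_m u¹ + L w¹ = 0`) with the DESIGN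
condition `ε̂·⟨σ,w¹⟩ + ⟨σ,u¹⟩ = 1`. Reference matrix `M = M_odd(dataK base [c₁,c₂] (all +1))`; `u = z∘inl`, `v = z∘inr`, `q₁, q₂` the auxiliary indices.
* ★ `twoPrime_core`: if the base rows of `M z` vanish and the two auxiliary row-sums of `M z` vanish, then `u(q₁)+v(q₁) = u(q₂)+v(q₂)`
  (direction `w`), `u(q₁) = u(q₂)` (direction `u`) and `v(q₂) = ε̂·0 = 0`-type identity `v(q₂) = 0`. Mechanism: the base rows say
  `N_B(u_B + u(q₁)1; w_B) = e·(ε̂σ; m+σ)` with `e = w(q₁)+w(q₂)`; pairing with the left-kernel vector of `…LeftKernel` gives `e·(ε̂σw¹ + σu¹) = e = 0`.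
* ★ `twoPrime_S3`: if moreover `z` is `Q`-constant in both halves and ALL rows of `M z` vanish, then `z = 0`, provided every virtual kernel pair
  of the base is `0` or `(u¹, w¹)` (`s* = 2`): the base part of `z` is then a virtual kernel pair, and the `q₂`-rows force it to be `0` by the
  design condition.
Characteristic-2 algebra is closed by `linear_combination (norm := skip) …; ring_nf; reduce_mod_char`.

HONEST FRAMING: linear algebra over `𝔽₂`; the crux (C⁺), its stubs and BSD untouched; nothing closed. THEOREMS ONLY.
Reference: [HeathBrown1994] appendix (Monsky), typescript pp. 39–41.
-/

namespace Summit.BirchSwinnertonDyer.BirchSwinnertonDyer.Theorems.SymbolicMonsky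

section TwoPrimeCore

open Matrix

variable {k : ℕ} (base : SymbData (k + 1)) (c₁ c₂ : AuxCell)

/-- **Core of the two-prime recipe.** For the reference matrix of `(base, [c₁, c₂])` with `c₁ ≡ 3 (4)`, `c₂ ≡ 1 (4)`, equal
`(2/·)`-classes, `c₁`'s bits `= m + σ` (`σ` = `c₂`'s bits) of odd weight, and a virtual kernel pair `(u¹, w¹)` of the base with
`ε̂·σw¹ + σu¹ = 1`: every `z` killed by the base rows and by the two auxiliary row-sums has `w(q₁) = w(q₂)`, `u(q₁) = u(q₂)` and
`v(q₂) = 0` (`u = inl`, `v = inr`, `w = u + v`). -/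
theorem twoPrime_core (hm1 : negNegOne c₁.1 = true) (hm2 : negNegOne c₂.1 = false) (hd : negTwo c₁.1 = negTwo c₂.1)
    (hσ : ∀ b : Fin (k + 1), c₁.2.testBit b.val = xor (negNegOne (base.cls b)) (c₂.2.testBit b.val))
    (hodd : (∑ b : Fin (k + 1), bz (c₂.2.testBit b.val)) = 1)
    (u1 w1 : Fin (k + 1) → ZMod 2)
    (hE1 : ∀ i, (∑ j, bz (base.neg i j) * (u1 j + u1 i)) + bz (negNegOne (base.cls i)) * u1 i + bz (negTwo (base.cls i)) * w1 i = 0)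
    (hE2 : ∀ i, bz (negNegOne (base.cls i)) * u1 i + ∑ j, bz (base.neg i j) * (w1 j + w1 i) = 0)
    (hdes : bz (negTwo c₂.1) * (∑ b : Fin (k + 1), bz (c₂.2.testBit b.val) * w1 b) +
      (∑ b : Fin (k + 1), bz (c₂.2.testBit b.val) * u1 b) = 1)
    (z : Fin (k + 1 + [c₁, c₂].length) ⊕ Fin (k + 1 + [c₁, c₂].length) → ZMod 2)
    (hrow1 : ∀ b : Fin (k + 1), ((dataK base [c₁, c₂] (fun _ _ => false)).monskyOddS *ᵥ z) (Sum.inl (Fin.castAdd _ b)) = 0)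
    (hrow2 : ∀ b : Fin (k + 1), ((dataK base [c₁, c₂] (fun _ _ => false)).monskyOddS *ᵥ z) (Sum.inr (Fin.castAdd _ b)) = 0)
    (hs1 : (∑ j : Fin [c₁, c₂].length, ((dataK base [c₁, c₂] (fun _ _ => false)).monskyOddS *ᵥ z) (Sum.inl (Fin.natAdd (k + 1) j))) = 0)
    (hs2 : (∑ j : Fin [c₁, c₂].length, ((dataK base [c₁, c₂] (fun _ _ => false)).monskyOddS *ᵥ z) (Sum.inr (Fin.natAdd (k + 1) j))) = 0) :
    (z (Sum.inl (Fin.natAdd (k + 1) (⟨0, by simp⟩ : Fin [c₁, c₂].length))) + z (Sum.inr (Fin.natAdd (k + 1) (⟨0, by simp⟩ : Fin [c₁, c₂].length)))) +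
      (z (Sum.inl (Fin.natAdd (k + 1) (⟨1, by simp⟩ : Fin [c₁, c₂].length))) + z (Sum.inr (Fin.natAdd (k + 1) (⟨1, by simp⟩ : Fin [c₁, c₂].length)))) = 0 ∧
    z (Sum.inl (Fin.natAdd (k + 1) (⟨0, by simp⟩ : Fin [c₁, c₂].length))) = z (Sum.inl (Fin.natAdd (k + 1) (⟨1, by simp⟩ : Fin [c₁, c₂].length))) ∧
    z (Sum.inr (Fin.natAdd (k + 1) (⟨1, by simp⟩ : Fin [c₁, c₂].length))) = 0 := by
  set q1 : Fin [c₁, c₂].length := ⟨0, by simp⟩ with hq1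
  set q2 : Fin [c₁, c₂].length := ⟨1, by simp⟩ with hq2
  set u₁ := z (Sum.inl (Fin.natAdd (k + 1) q1)) with hu₁
  set u₂ := z (Sum.inl (Fin.natAdd (k + 1) q2)) with hu₂
  set v₁ := z (Sum.inr (Fin.natAdd (k + 1) q1)) with hv₁
  set v₂ := z (Sum.inr (Fin.natAdd (k + 1) q2)) with hv₂
  have hc1 : ([c₁, c₂].getD (0 : ℕ) (0, 0)) = c₁ := rfl
  have hc2 : ([c₁, c₂].getD (1 : ℕ) (0, 0)) = c₂ := rfl
  have hσ' : ∀ b : Fin (k + 1), bz (c₁.2.testBit b.val) = bz (negNegOne (base.cls b)) + bz (c₂.2.testBit b.val) := fun b => by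
    rw [hσ b, bz_xor_add]
  have hN2c1 : bz (negNegTwo c₁.1) = bz (negTwo c₂.1) + 1 := by
    have h := bz_negNegOne_add_bz_negNegTwo c₁.1
    rw [hm1, hd] at h
    have h1 : bz true = (1 : ZMod 2) := rfl
    rw [h1] at h
    linear_combination (norm := skip) h
    ring_nf
    try reduce_mod_char
  have hN2c2 : bz (negNegTwo c₂.1) = bz (negTwo c₂.1) := by
    have h := bz_negNegOne_add_bz_negNegTwo c₂.1
    rw [hm2] at h
    have h0 : bz false = (0 : ZMod 2) := rfl
    rw [h0, zero_add] at h
    exact h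
  have hEc1 : bz (negTwo c₁.1) = bz (negTwo c₂.1) := by rw [hd]
  -- base rows
  have R1 : ∀ i : Fin (k + 1), (∑ j, bz (base.neg i j) * (z (Sum.inl (Fin.castAdd _ j)) + z (Sum.inl (Fin.castAdd _ i)))) +
      ((bz (negNegOne (base.cls i)) + bz (c₂.2.testBit i.val)) * (u₁ + z (Sum.inl (Fin.castAdd _ i))) +
        bz (c₂.2.testBit i.val) * (u₂ + z (Sum.inl (Fin.castAdd _ i)))) +
      bz (negTwo (base.cls i)) * (z (Sum.inl (Fin.castAdd _ i)) + z (Sum.inr (Fin.castAdd _ i))) = 0 := by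
    intro i
    have h := hrow1 i
    rw [mulVec_inl_castAdd_expand, sum_fin_two_cells] at h
    simp only [hc1, hc2, hσ'] at h
    exact h
  have R2 : ∀ i : Fin (k + 1), bz (negTwo (base.cls i)) * z (Sum.inl (Fin.castAdd _ i)) +
      ((∑ j, bz (base.neg i j) * (z (Sum.inr (Fin.castAdd _ j)) + z (Sum.inr (Fin.castAdd _ i)))) +
       ((bz (negNegOne (base.cls i)) + bz (c₂.2.testBit i.val)) * (v₁ + z (Sum.inr (Fin.castAdd _ i))) +
        bz (c₂.2.testBit i.val) * (v₂ + z (Sum.inr (Fin.castAdd _ i))))) +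
      bz (negNegTwo (base.cls i)) * z (Sum.inr (Fin.castAdd _ i)) = 0 := by
    intro i
    have h := hrow2 i
    rw [mulVec_inr_castAdd_expand, sum_fin_two_cells] at h
    simp only [hc1, hc2, hσ'] at h
    exact h
  -- auxiliary row sums
  have S1eq : (∑ b : Fin (k + 1), bz (c₂.2.testBit b.val) * z (Sum.inl (Fin.castAdd _ b))) +
      (∑ b : Fin (k + 1), bz (c₂.2.testBit b.val)) * u₁ + bz (negTwo c₂.1) * (u₁ + v₁) +
      ((∑ b : Fin (k + 1), bz (c₂.2.testBit b.val) * z (Sum.inl (Fin.castAdd _ b))) +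
        (∑ b : Fin (k + 1), bz (c₂.2.testBit b.val)) * u₂ + bz (negTwo c₂.1) * (u₂ + v₂)) = 0 := by
    have h := hs1
    rw [sum_fin_two_cells] at h
    rw [mulVec_inl_natAdd_expand, mulVec_inl_natAdd_expand, sum_mutual_ref_eq_zero base c₁ c₂ hm2,
      sum_mutual_ref_eq_zero base c₁ c₂ hm2, add_zero, add_zero] at h
    simp only [bz_neg_natAdd_castAdd_two base c₁ c₂ hσ hm1 hm2, hc1, hc2, hEc1] at h
    rw [sum_cell_mul_add c₂ _ u₁, sum_cell_mul_add c₂ _ u₂] at h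
    exact h
  have S2eq : bz (negTwo c₂.1) * u₁ + ((∑ b : Fin (k + 1), bz (c₂.2.testBit b.val) * z (Sum.inr (Fin.castAdd _ b))) +
      (∑ b : Fin (k + 1), bz (c₂.2.testBit b.val)) * v₁) + (bz (negTwo c₂.1) + 1) * v₁ +
      (bz (negTwo c₂.1) * u₂ + ((∑ b : Fin (k + 1), bz (c₂.2.testBit b.val) * z (Sum.inr (Fin.castAdd _ b))) +
        (∑ b : Fin (k + 1), bz (c₂.2.testBit b.val)) * v₂) + bz (negTwo c₂.1) * v₂) = 0 := by
    have h := hs2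
    rw [sum_fin_two_cells] at h
    rw [mulVec_inr_natAdd_expand, mulVec_inr_natAdd_expand, sum_mutual_ref_eq_zero base c₁ c₂ hm2,
      sum_mutual_ref_eq_zero base c₁ c₂ hm2, add_zero, add_zero] at h
    simp only [bz_neg_natAdd_castAdd_two base c₁ c₂ hσ hm1 hm2, hc1, hc2, hEc1, hN2c1, hN2c2] at h
    rw [sum_cell_mul_add c₂ _ v₁, sum_cell_mul_add c₂ _ v₂] at h
    exact h
  rw [hodd] at S1eq S2eq
  -- a = E e and v₂ = E e  (e = u₁+v₁+u₂+v₂)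
  have ha : u₁ + u₂ = bz (negTwo c₂.1) * (u₁ + v₁ + u₂ + v₂) := by
    linear_combination (norm := skip) S1eq
    ring_nf
    try reduce_mod_char
  have hv2 : v₂ = bz (negTwo c₂.1) * (u₁ + v₁ + u₂ + v₂) := by
    linear_combination (norm := skip) S2eq
    ring_nf
    try reduce_mod_char
  have hv1 : v₁ = u₁ + v₁ + u₂ + v₂ := by
    linear_combination (norm := skip) ha - hv2
    ring_nf
    try reduce_mod_char
  -- per-index values of the base expressions on x = ub + u₁·1, y = ub + vb
  have hX1 : ∀ i : Fin (k + 1), (∑ j, bz (base.neg i j) * ((z (Sum.inl (Fin.castAdd _ j)) + u₁) + (z (Sum.inl (Fin.castAdd _ i)) + u₁))) +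
      bz (negNegOne (base.cls i)) * (z (Sum.inl (Fin.castAdd _ i)) + u₁) +
      bz (negTwo (base.cls i)) * (z (Sum.inl (Fin.castAdd _ i)) + z (Sum.inr (Fin.castAdd _ i))) = bz (c₂.2.testBit i.val) * (u₁ + u₂) := by
    intro i
    have R1i := R1 i
    rw [sum_neg_shift base i (fun j => z (Sum.inl (Fin.castAdd _ j))) u₁]
    set S := ∑ j, bz (base.neg i j) * (z (Sum.inl (Fin.castAdd [c₁, c₂].length j)) + z (Sum.inl (Fin.castAdd [c₁, c₂].length i))) with hS
    linear_combination (norm := skip) R1i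
    ring_nf
    try reduce_mod_char
  have hX2 : ∀ i : Fin (k + 1), bz (negNegOne (base.cls i)) * (z (Sum.inl (Fin.castAdd _ i)) + u₁) +
      (∑ j, bz (base.neg i j) * ((z (Sum.inl (Fin.castAdd _ j)) + z (Sum.inr (Fin.castAdd _ j))) +
        (z (Sum.inl (Fin.castAdd _ i)) + z (Sum.inr (Fin.castAdd _ i))))) =
      (bz (negNegOne (base.cls i)) + bz (c₂.2.testBit i.val)) * (u₁ + v₁ + u₂ + v₂) := by
    intro i
    have R1i := R1 i
    have R2i := R2 i
    rw [sum_neg_add base i (fun j => z (Sum.inl (Fin.castAdd _ j))) (fun j => z (Sum.inr (Fin.castAdd _ j)))]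
    have hmd : bz (negNegOne (base.cls i)) + bz (negNegTwo (base.cls i)) = bz (negTwo (base.cls i)) :=
      bz_negNegOne_add_bz_negNegTwo (base.cls i)
    set S := ∑ j, bz (base.neg i j) * (z (Sum.inl (Fin.castAdd [c₁, c₂].length j)) + z (Sum.inl (Fin.castAdd [c₁, c₂].length i))) with hS
    set T := ∑ j, bz (base.neg i j) * (z (Sum.inr (Fin.castAdd [c₁, c₂].length j)) + z (Sum.inr (Fin.castAdd [c₁, c₂].length i))) with hT
    linear_combination (norm := skip) R1i + R2i + z (Sum.inr (Fin.castAdd _ i)) * hmd + bz (negNegOne (base.cls i)) * hv1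
    ring_nf
    try reduce_mod_char
  -- the pairing with the virtual kernel pair
  have P := SymbData.leftKernel_pairing base u1 w1 hE1 hE2 (fun b => z (Sum.inl (Fin.castAdd [c₁, c₂].length b)) + u₁)
    (fun b => z (Sum.inl (Fin.castAdd [c₁, c₂].length b)) + z (Sum.inr (Fin.castAdd [c₁, c₂].length b)))
  simp only [hX1, hX2] at P
  have t3 := SymbData.inner_m_eq base u1 w1 hE2
  have P1 : (∑ i : Fin (k + 1), w1 i * (bz (c₂.2.testBit i.val) * (u₁ + u₂))) =
      (u₁ + u₂) * ∑ b : Fin (k + 1), bz (c₂.2.testBit b.val) * w1 b := by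
    rw [Finset.mul_sum]; exact Finset.sum_congr rfl fun i _ => by ring
  have P2 : (∑ i : Fin (k + 1), (u1 i + ∑ l : Fin (k + 1), bz (negNegOne (base.cls l)) * w1 l) *
        ((bz (negNegOne (base.cls i)) + bz (c₂.2.testBit i.val)) * (u₁ + v₁ + u₂ + v₂))) =
      (u₁ + v₁ + u₂ + v₂) * ((∑ i : Fin (k + 1), bz (negNegOne (base.cls i)) * u1 i) +
        (∑ b : Fin (k + 1), bz (c₂.2.testBit b.val) * u1 b) +
        (∑ l : Fin (k + 1), bz (negNegOne (base.cls l)) * w1 l) * (∑ i : Fin (k + 1), bz (negNegOne (base.cls i))) +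
        (∑ l : Fin (k + 1), bz (negNegOne (base.cls l)) * w1 l) * (∑ b : Fin (k + 1), bz (c₂.2.testBit b.val))) := by
    rw [mul_add, mul_add, mul_add, Finset.mul_sum, Finset.mul_sum, Finset.mul_sum, Finset.mul_sum, Finset.mul_sum, Finset.mul_sum,
      ← Finset.sum_add_distrib, ← Finset.sum_add_distrib, ← Finset.sum_add_distrib]
    exact Finset.sum_congr rfl fun i _ => by ring
  rw [P1, P2, hodd] at P
  have he0 : u₁ + v₁ + u₂ + v₂ = 0 := by
    have h1 : (u₁ + v₁ + u₂ + v₂) * (bz (negTwo c₂.1) * (∑ b : Fin (k + 1), bz (c₂.2.testBit b.val) * w1 b) +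
        (∑ b : Fin (k + 1), bz (c₂.2.testBit b.val) * u1 b)) = 0 := by
      linear_combination (norm := skip) P - (u₁ + v₁ + u₂ + v₂) * t3 + ha * (∑ b : Fin (k + 1), bz (c₂.2.testBit b.val) * w1 b)
      ring_nf
      try reduce_mod_char
    rw [hdes, mul_one] at h1
    exact h1
  refine ⟨by linear_combination (norm := skip) he0; ring_nf; try reduce_mod_char, ?_, ?_⟩
  · have : u₁ + u₂ = 0 := by rw [ha, he0, mul_zero]
    exact (zmod_two_eq_iff_add_eq_zero _ _).mpr this
  · rw [hv2, he0, mul_zero]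


/-- **Injectivity on `Q`-constant vectors** (stage S3 of the semantic closure criterion) for the two-prime recipe. -/
theorem twoPrime_S3 (hm1 : negNegOne c₁.1 = true) (hm2 : negNegOne c₂.1 = false) (hd : negTwo c₁.1 = negTwo c₂.1)
    (hσ : ∀ b : Fin (k + 1), c₁.2.testBit b.val = xor (negNegOne (base.cls b)) (c₂.2.testBit b.val))
    (hodd : (∑ b : Fin (k + 1), bz (c₂.2.testBit b.val)) = 1)
    (u1 w1 : Fin (k + 1) → ZMod 2)
    (hE1 : ∀ i, (∑ j, bz (base.neg i j) * (u1 j + u1 i)) + bz (negNegOne (base.cls i)) * u1 i + bz (negTwo (base.cls i)) * w1 i = 0)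
    (hE2 : ∀ i, bz (negNegOne (base.cls i)) * u1 i + ∑ j, bz (base.neg i j) * (w1 j + w1 i) = 0)
    (hker : ∀ x y : Fin (k + 1) → ZMod 2,
      (∀ i, (∑ j, bz (base.neg i j) * (x j + x i)) + bz (negNegOne (base.cls i)) * x i + bz (negTwo (base.cls i)) * y i = 0) →
      (∀ i, bz (negNegOne (base.cls i)) * x i + ∑ j, bz (base.neg i j) * (y j + y i) = 0) →
      (x = 0 ∧ y = 0) ∨ (x = u1 ∧ y = w1))
    (hdes : bz (negTwo c₂.1) * (∑ b : Fin (k + 1), bz (c₂.2.testBit b.val) * w1 b) +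
      (∑ b : Fin (k + 1), bz (c₂.2.testBit b.val) * u1 b) = 1)
    (z : Fin (k + 1 + [c₁, c₂].length) ⊕ Fin (k + 1 + [c₁, c₂].length) → ZMod 2)
    (hconst : ∀ i j, auxQ k [c₁, c₂].length i = true → auxQ k [c₁, c₂].length j = true →
      z (Sum.inl i) = z (Sum.inl j) ∧ z (Sum.inr i) = z (Sum.inr j))
    (hz : (dataK base [c₁, c₂] (fun _ _ => false)).monskyOddS *ᵥ z = 0) : z = 0 := by
  set q1 : Fin [c₁, c₂].length := ⟨0, by simp⟩ with hq1
  set q2 : Fin [c₁, c₂].length := ⟨1, by simp⟩ with hq2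
  have hrow1 : ∀ b : Fin (k + 1), ((dataK base [c₁, c₂] (fun _ _ => false)).monskyOddS *ᵥ z) (Sum.inl (Fin.castAdd _ b)) = 0 :=
    fun b => by rw [hz]; rfl
  have hrow2 : ∀ b : Fin (k + 1), ((dataK base [c₁, c₂] (fun _ _ => false)).monskyOddS *ᵥ z) (Sum.inr (Fin.castAdd _ b)) = 0 :=
    fun b => by rw [hz]; rfl
  have hA : ∀ j, ((dataK base [c₁, c₂] (fun _ _ => false)).monskyOddS *ᵥ z) (Sum.inl (Fin.natAdd (k + 1) j)) = 0 :=
    fun j => by rw [hz]; rfl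
  have hB : ∀ j, ((dataK base [c₁, c₂] (fun _ _ => false)).monskyOddS *ᵥ z) (Sum.inr (Fin.natAdd (k + 1) j)) = 0 :=
    fun j => by rw [hz]; rfl
  have core := twoPrime_core base c₁ c₂ hm1 hm2 hd hσ hodd u1 w1 hE1 hE2 hdes z hrow1 hrow2
    (Finset.sum_eq_zero fun j _ => hA j) (Finset.sum_eq_zero fun j _ => hB j)
  obtain ⟨he0, hu12, hv2⟩ := core
  obtain ⟨hcu, hcv⟩ := hconst (Fin.natAdd (k + 1) q1) (Fin.natAdd (k + 1) q2) (auxQ_natAdd _ q1) (auxQ_natAdd _ q2)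
  set α := z (Sum.inl (Fin.natAdd (k + 1) q1)) with hα
  have hu2 : z (Sum.inl (Fin.natAdd (k + 1) q2)) = α := hcu.symm
  have hv1 : z (Sum.inr (Fin.natAdd (k + 1) q1)) = 0 := by rw [hcv, hv2]
  have hc1 : ([c₁, c₂].getD (0 : ℕ) (0, 0)) = c₁ := rfl
  have hc2 : ([c₁, c₂].getD (1 : ℕ) (0, 0)) = c₂ := rfl
  have hσ' : ∀ b : Fin (k + 1), bz (c₁.2.testBit b.val) = bz (negNegOne (base.cls b)) + bz (c₂.2.testBit b.val) := fun b => by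
    rw [hσ b, bz_xor_add]
  -- base rows with u₁ = u₂ = α, v₁ = v₂ = 0
  have R1 : ∀ i : Fin (k + 1), (∑ j, bz (base.neg i j) * (z (Sum.inl (Fin.castAdd _ j)) + z (Sum.inl (Fin.castAdd _ i)))) +
      ((bz (negNegOne (base.cls i)) + bz (c₂.2.testBit i.val)) * (α + z (Sum.inl (Fin.castAdd _ i))) +
        bz (c₂.2.testBit i.val) * (α + z (Sum.inl (Fin.castAdd _ i)))) +
      bz (negTwo (base.cls i)) * (z (Sum.inl (Fin.castAdd _ i)) + z (Sum.inr (Fin.castAdd _ i))) = 0 := by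
    intro i
    have h := hrow1 i
    rw [mulVec_inl_castAdd_expand, sum_fin_two_cells] at h
    simp only [hc1, hc2, hσ'] at h
    rw [hu2] at h
    exact h
  have R2 : ∀ i : Fin (k + 1), bz (negTwo (base.cls i)) * z (Sum.inl (Fin.castAdd _ i)) +
      ((∑ j, bz (base.neg i j) * (z (Sum.inr (Fin.castAdd _ j)) + z (Sum.inr (Fin.castAdd _ i)))) +
       ((bz (negNegOne (base.cls i)) + bz (c₂.2.testBit i.val)) * (0 + z (Sum.inr (Fin.castAdd _ i))) +
        bz (c₂.2.testBit i.val) * (0 + z (Sum.inr (Fin.castAdd _ i))))) +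
      bz (negNegTwo (base.cls i)) * z (Sum.inr (Fin.castAdd _ i)) = 0 := by
    intro i
    have h := hrow2 i
    rw [mulVec_inr_castAdd_expand, sum_fin_two_cells] at h
    simp only [hc1, hc2, hσ'] at h
    rw [hv1, hv2] at h
    exact h
  -- the base pair (x, y) = (ub + α, ub + vb) is a virtual kernel pair
  have hx1 : ∀ i, (∑ j, bz (base.neg i j) * ((z (Sum.inl (Fin.castAdd [c₁, c₂].length j)) + α) + (z (Sum.inl (Fin.castAdd [c₁, c₂].length i)) + α))) +
      bz (negNegOne (base.cls i)) * (z (Sum.inl (Fin.castAdd [c₁, c₂].length i)) + α) +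
      bz (negTwo (base.cls i)) * (z (Sum.inl (Fin.castAdd [c₁, c₂].length i)) + z (Sum.inr (Fin.castAdd [c₁, c₂].length i))) = 0 := by
    intro i
    have R1i := R1 i
    rw [sum_neg_shift base i (fun j => z (Sum.inl (Fin.castAdd _ j))) α]
    set S := ∑ j, bz (base.neg i j) * (z (Sum.inl (Fin.castAdd [c₁, c₂].length j)) + z (Sum.inl (Fin.castAdd [c₁, c₂].length i))) with hS
    linear_combination (norm := skip) R1i
    ring_nf
    try reduce_mod_char
  have hx2 : ∀ i, bz (negNegOne (base.cls i)) * (z (Sum.inl (Fin.castAdd [c₁, c₂].length i)) + α) +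
      (∑ j, bz (base.neg i j) * ((z (Sum.inl (Fin.castAdd [c₁, c₂].length j)) + z (Sum.inr (Fin.castAdd [c₁, c₂].length j))) +
        (z (Sum.inl (Fin.castAdd [c₁, c₂].length i)) + z (Sum.inr (Fin.castAdd [c₁, c₂].length i))))) = 0 := by
    intro i
    have R1i := R1 i
    have R2i := R2 i
    rw [sum_neg_add base i (fun j => z (Sum.inl (Fin.castAdd _ j))) (fun j => z (Sum.inr (Fin.castAdd _ j)))]
    have hmd : bz (negNegOne (base.cls i)) + bz (negNegTwo (base.cls i)) = bz (negTwo (base.cls i)) :=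
      bz_negNegOne_add_bz_negNegTwo (base.cls i)
    set S := ∑ j, bz (base.neg i j) * (z (Sum.inl (Fin.castAdd [c₁, c₂].length j)) + z (Sum.inl (Fin.castAdd [c₁, c₂].length i))) with hS
    set T := ∑ j, bz (base.neg i j) * (z (Sum.inr (Fin.castAdd [c₁, c₂].length j)) + z (Sum.inr (Fin.castAdd [c₁, c₂].length i))) with hT
    linear_combination (norm := skip) R1i + R2i + z (Sum.inr (Fin.castAdd _ i)) * hmd
    ring_nf
    try reduce_mod_char
  -- the two auxiliary rows of q₂
  have hEc1 : bz (negTwo c₁.1) = bz (negTwo c₂.1) := by rw [hd]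
  have A1 : (∑ b : Fin (k + 1), bz (c₂.2.testBit b.val) * (z (Sum.inl (Fin.castAdd [c₁, c₂].length b)) + α)) +
      bz (negTwo c₂.1) * α = 0 := by
    have h := hA q2
    rw [mulVec_inl_natAdd_expand, sum_mutual_ref_eq_zero base c₁ c₂ hm2, add_zero] at h
    simp only [bz_neg_natAdd_castAdd_two base c₁ c₂ hσ hm1 hm2] at h
    rw [hu2, hv2, add_zero] at h
    exact h
  have A2 : bz (negTwo c₂.1) * α +
      (∑ b : Fin (k + 1), bz (c₂.2.testBit b.val) * (z (Sum.inr (Fin.castAdd [c₁, c₂].length b)) + 0)) = 0 := by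
    have h := hB q2
    rw [mulVec_inr_natAdd_expand, sum_mutual_ref_eq_zero base c₁ c₂ hm2, add_zero] at h
    simp only [bz_neg_natAdd_castAdd_two base c₁ c₂ hσ hm1 hm2] at h
    rw [hu2, hv2, mul_zero, add_zero] at h
    exact h
  -- sums over the cells
  set SX := ∑ b : Fin (k + 1), bz (c₂.2.testBit b.val) * (z (Sum.inl (Fin.castAdd [c₁, c₂].length b)) + α) with hSX
  set SY := ∑ b : Fin (k + 1), bz (c₂.2.testBit b.val) *
    (z (Sum.inl (Fin.castAdd [c₁, c₂].length b)) + z (Sum.inr (Fin.castAdd [c₁, c₂].length b))) with hSY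
  have A2' : bz (negTwo c₂.1) * α + (SY + SX + α) = 0 := by
    have e : (∑ b : Fin (k + 1), bz (c₂.2.testBit b.val) * (z (Sum.inr (Fin.castAdd [c₁, c₂].length b)) + 0)) = SY + SX + α := by
      have : (∑ b : Fin (k + 1), bz (c₂.2.testBit b.val) * (z (Sum.inr (Fin.castAdd [c₁, c₂].length b)) + 0)) =
          SY + SX + (∑ b : Fin (k + 1), bz (c₂.2.testBit b.val)) * α := by
        rw [hSY, hSX, Finset.sum_mul, ← Finset.sum_add_distrib, ← Finset.sum_add_distrib]
        refine Finset.sum_congr rfl fun b _ => ?_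
        ring_nf
        try reduce_mod_char
      rw [this, hodd, one_mul]
    rw [e] at A2; exact A2
  have hαSY : α = SY := by
    linear_combination (norm := skip) A1 + A2'
    ring_nf
    try reduce_mod_char
  -- dichotomy from `hker`
  rcases hker (fun b => z (Sum.inl (Fin.castAdd [c₁, c₂].length b)) + α)
      (fun b => z (Sum.inl (Fin.castAdd [c₁, c₂].length b)) + z (Sum.inr (Fin.castAdd [c₁, c₂].length b))) hx1 hx2 with ⟨hx0, hy0⟩ | ⟨hxu, hyw⟩
  · -- x = 0, y = 0: everything vanishes
    have hSY0 : SY = 0 := by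
      rw [hSY]; exact Finset.sum_eq_zero fun b _ => by
        have := congrFun hy0 b; simp only [Pi.zero_apply] at this; rw [this, mul_zero]
    have hα0 : α = 0 := by rw [hαSY, hSY0]
    have hub : ∀ b, z (Sum.inl (Fin.castAdd [c₁, c₂].length b)) = 0 := fun b => by
      have := congrFun hx0 b; simp only [Pi.zero_apply] at this; rw [hα0, add_zero] at this; exact this
    have hvb : ∀ b, z (Sum.inr (Fin.castAdd [c₁, c₂].length b)) = 0 := fun b => by
      have := congrFun hy0 b; simp only [Pi.zero_apply] at this; rw [hub b, zero_add] at this; exact this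
    funext idx
    rcases idx with i | i
    · refine Fin.addCases (fun b => ?_) (fun j => ?_) i
      · exact hub b
      · rcases fin_two_cells_cases c₁ c₂ j with rfl | rfl
        · exact hα0
        · rw [Pi.zero_apply, hu2, hα0]
    · refine Fin.addCases (fun b => ?_) (fun j => ?_) i
      · exact hvb b
      · rcases fin_two_cells_cases c₁ c₂ j with rfl | rfl
        · exact hv1
        · exact hv2
  · -- x = u¹, y = w¹ contradicts the design condition
    exfalso
    have hSXu : SX = ∑ b : Fin (k + 1), bz (c₂.2.testBit b.val) * u1 b := by
      rw [hSX]; exact Finset.sum_congr rfl fun b _ => by rw [← congrFun hxu b]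
    have hSYw : SY = ∑ b : Fin (k + 1), bz (c₂.2.testBit b.val) * w1 b := by
      rw [hSY]; exact Finset.sum_congr rfl fun b _ => by rw [← congrFun hyw b]
    have h1 : SX + bz (negTwo c₂.1) * SY = 0 := by
      linear_combination (norm := skip) A1 + bz (negTwo c₂.1) * hαSY
      ring_nf
      try reduce_mod_char
    rw [hSXu, hSYw] at h1
    have : (1 : ZMod 2) = 0 := by
      rw [← hdes]
      linear_combination (norm := skip) h1
      ring_nf
      try reduce_mod_char
    exact one_ne_zero this


end TwoPrimeCore

end Summit.BirchSwinnertonDyer.BirchSwinnertonDyer.Theorems.SymbolicMonsky
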